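import Summits.CriticalPhenomena.PercolationContinuityZ3.Theorems.SahiMasterFamilyStructRemoval

/-!
# Structure theory of the zero-flag class, V: removable members are last-able (SYM)

Unit `prim-master-conj` (crux anchor stmt-CriticalPhenomena-4575); STRUCTURE-THEORY.md §3.8 (gen 6).  **SYM**: if `W` and `W ∖ v` are
structured then the annihilator of `v` (canonical frame minus member) lies in the safe region of `W ∖ v`
(`annihilator_subset_safe_erase`); consequently `v` can be appended to ANY good chain of `W ∖ v` (`goodChain_cons_of_structured_erase`)
— the order-flexibility of structured families ("F2" of the unit's notes).  Proof by induction on the size, using C (removability) in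
chain form, T1 (safe region via frames) in both directions, robust restriction of frames, and a compatibility argument between the
annihilator of `v` and the annihilator of the last member of a chain.  Pure combinatorics; axioms standard. [this work]
-/

noncomputable section

open scoped Classical

namespace Summit.CriticalPhenomena.PercolationContinuityZ3.Theorems

open Finset Function
open Literature.Probability.LatticeModels.Kahn2022 (Affects)

variable {ι : Type*} [Fintype ι] {κ : Type*} (U : κ → Set (Set ι))

omit [Fintype ι] in
/-- The fail set is monotone in the family. [this work] -/
theorem failSet_mono {W₁ W₂ : Finset κ} (h : W₁ ⊆ W₂) (φ : Set ι) : failSet U W₁ φ ⊆ failSet U W₂ φ := by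
  intro w hw; rw [mem_failSet] at hw ⊢; exact ⟨h hw.1, hw.2⟩

/-- Frame supports of good chains compare through the canonical frames: if the frames of `R` are those of `W₂` restricted, then a good
chain of `R` has frame support inside that of a good chain of `W₂`. [this work] -/
theorem frameSupp_subset_of_cframe_eq (hU : ∀ k, IsUpperSet (U k)) (hne : ∀ k, (U k).Nonempty) {l₀ l₂ : List κ}
    (hl₀ : GoodChain U l₀) (hl₂ : GoodChain U l₂) (hsub : l₀.toFinset ⊆ l₂.toFinset)
    (hfr : ∀ w ∈ l₀.toFinset, cframe U l₀.toFinset w = cframe U l₂.toFinset w) : frameSupp U l₀ ⊆ frameSupp U l₂ := by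
  rw [frameSupp_eq_biUnion_cframe U hU hne hl₀, frameSupp_eq_biUnion_cframe U hU hne hl₂]
  intro i hi
  rw [Set.mem_iUnion₂] at hi ⊢
  obtain ⟨w, hw, hiw⟩ := hi
  exact ⟨w, hsub hw, by rwa [← hfr w hw]⟩

/-- **SYM, inductive form** (STRUCTURE-THEORY 3.8): in a structured family, the annihilator of a member with non-empty annihilator is
safe for the rest. [this work] -/
theorem annihilator_subset_safe_erase_aux (hU : ∀ k, IsUpperSet (U k)) (hne : ∀ k, (U k).Nonempty) :
    ∀ (n : ℕ) {W : Finset κ}, W.card ≤ n → Structured U W → ∀ {v : κ}, v ∈ W → ¬ (cframe U W v ⊆ U v) →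
      cframe U W v \ U v ⊆ Safe U (W.erase v)
  | 0, W, hn, _, v, hv, _ => by
    rw [Nat.le_zero, card_eq_zero] at hn; subst hn; exact absurd hv (notMem_empty v)
  | n + 1, W, hn, hW, v, hv, hNv => by
    obtain ⟨l, hlW, hl⟩ := id hW
    match l, hlW, hl with
    | [], hlW, _ => subst hlW; exact absurd hv (by simp)
    | u :: l', hlW, hl =>
      have hul' : u ∉ l' := ((goodChain_cons U).1 hl).2.1
      have hl' : GoodChain U l' := GoodChain.tail U hl
      by_cases hvu : v = u
      · -- `v` is the last member of the chain: the defining clause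
        subst hvu
        have e : W.erase v = l'.toFinset := by
          rw [← hlW, List.toFinset_cons, erase_insert (fun h => hul' (List.mem_toFinset.1 h))]
        rw [e, ← hlW, ← frameIn_eq_cframe U hU hne hl (List.mem_cons_self), frameIn_cons_self]
        exact ((goodChain_cons U).1 hl).2.2
      · -- `v` inside: W' := the family of `l'`
        have hvl' : v ∈ l' := by
          have : v ∈ (u :: l').toFinset := hlW.symm ▸ hv
          simpa [hvu] using this
        set W' : Finset κ := l'.toFinset with hW'def
        have hW's : Structured U W' := ⟨l', rfl, hl'⟩
        have eW' : W.erase u = W' := by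
          rw [← hlW, List.toFinset_cons, erase_insert (fun h => hul' (List.mem_toFinset.1 h))]
        have hW'n : W'.card ≤ n := by
          have : W.card = W'.card + 1 := by
            rw [← hlW, List.toFinset_cons, card_insert_of_notMem (fun h => hul' (List.mem_toFinset.1 h))]
          omega
        have hvW' : v ∈ W' := List.mem_toFinset.2 hvl'
        -- the annihilator of `v` is the same in `W'`
        have ecf : cframe U W' v = cframe U W v := by
          rw [← eW']; exact cframe_erase U hU hne hW (eW'.symm ▸ hW's) (by rw [eW']; exact hvW')
        have hNv' : ¬ (cframe U W' v ⊆ U v) := by rwa [ecf]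
        -- C: `v` removable from `W'`, and `u` stays last
        obtain ⟨hW'v, hchain⟩ := goodChain_cons_of_erase U hU hne hl hvl' hNv'
        obtain ⟨l₂, hl₂W, hl₂⟩ := hW'v
        have hul₂ : GoodChain U (u :: l₂) := hchain l₂ hl₂W hl₂
        -- IH: the annihilator of `v` is safe for `W' ∖ v`
        have hIH : cframe U W' v \ U v ⊆ Safe U (W'.erase v) := annihilator_subset_safe_erase_aux hU hne n hW'n hW's hvW' hNv'
        -- supports: frameSupp l₂ ⊆ frameSupp l'
        have hS₂ : frameSupp U l₂ ⊆ frameSupp U l' :=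
          frameSupp_subset_of_cframe_eq U hU hne hl₂ hl' (by rw [hl₂W]; exact erase_subset v W')
            (fun w hw => by rw [hl₂W] at hw ⊢; exact cframe_erase U hU hne hW's ⟨l₂, hl₂W, hl₂⟩ hw)
        -- the goal
        have eWv : W.erase v = insert u (W'.erase v) := by
          rw [← hlW, List.toFinset_cons, erase_insert_of_ne (Ne.symm hvu)]
        intro φ hφ
        have hφ' : φ ∈ cframe U W' v \ U v := by rwa [ecf]
        have hφs := hIH hφ'
        rw [eWv, mem_safe]
        have hsubWv : W'.erase v ⊆ insert u (W'.erase v) := subset_insert u _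
        refine ⟨((mem_safe U).1 hφs).1.trans (card_le_card (failSet_mono U hsubWv φ)), fun R hR1 hR2 => ?_⟩
        have huWv : u ∉ W'.erase v := fun h => hul' (List.mem_toFinset.1 (mem_of_mem_erase h))
        by_cases huR : u ∈ R
        swap
        · -- `u ∉ R`: a superset inside `W' ∖ v`
          have hRsub : R ⊆ W'.erase v := fun x hx => (mem_insert.1 (hR2 hx)).resolve_left (fun h => huR (h ▸ hx))
          exact ((mem_safe U).1 hφs).2 R (fun x hx => hR1 (failSet_mono U hsubWv φ hx)) hRsub
        · -- `u ∈ R`: R = insert u R₀, and `u` is addable to the robust sub-family `R₀`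
          set R₀ : Finset κ := R.erase u with hR₀def
          have hR₀sub : R₀ ⊆ W'.erase v := by
            intro x hx
            exact (mem_insert.1 (hR2 (mem_of_mem_erase hx))).resolve_left (ne_of_mem_erase hx)
          set Q : Finset κ := failSet U (W'.erase v) φ with hQdef
          have hQR₀ : Q ⊆ R₀ := by
            intro x hx
            refine mem_erase.2 ⟨fun h => huWv (h ▸ failSet_subset U _ φ hx), hR1 (failSet_mono U hsubWv φ hx)⟩
          have hR₀rob : ∀ R', R₀ ⊆ R' → R' ⊆ W'.erase v → Structured U R' :=
            fun R' h1 h2 => ((mem_safe U).1 hφs).2 R' (hQR₀.trans h1) h2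
          have hR₀s : Structured U R₀ := hR₀rob R₀ subset_rfl hR₀sub
          have hWvs : Structured U (W'.erase v) := ⟨l₂, hl₂W, hl₂⟩
          have hfrR₀ : ∀ w ∈ R₀, cframe U R₀ w = cframe U (W'.erase v) w :=
            cframe_eq_of_robust U hU hne _ le_rfl hWvs hR₀sub hR₀rob
          obtain ⟨l₀, hl₀R, hl₀⟩ := hR₀s
          -- it suffices to make `u :: l₀` a good chain
          suffices hgoal : GoodChain U (u :: l₀) by
            refine ⟨u :: l₀, ?_, hgoal⟩
            rw [List.toFinset_cons, hl₀R, hR₀def, insert_erase huR]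
          rw [goodChain_cons]
          refine ⟨hl₀, fun h => (ne_of_mem_erase (hl₀R ▸ List.mem_toFinset.2 h : u ∈ R₀)) rfl, ?_⟩
          -- the annihilator of `u` over `R₀` is inside its annihilator over `W' ∖ v` and over `W'`
          have hS₀ : frameSupp U l₀ ⊆ frameSupp U l₂ :=
            frameSupp_subset_of_cframe_eq U hU hne hl₀ hl₂ (by rw [hl₀R, hl₂W]; exact hR₀sub)
              (fun w hw => by rw [hl₀R, hl₂W] at *; exact hfrR₀ w hw)
          have hT1W' := mem_safe_iff_cfail U hU hne hW's
          have hT1R₀ := mem_safe_iff_cfail U hU hne (⟨l₀, hl₀R, hl₀⟩ : Structured U R₀)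
          intro χ hχ
          -- `χ` is in the annihilator of `u` over `W'`, hence safe for `W'`
          have hχW' : χ ∈ Safe U W' := by
            refine ((goodChain_cons U).1 hl).2.2 ⟨?_, hχ.2⟩
            exact hull_mono_left (hU u) (hS₀.trans hS₂) hχ.1
          obtain ⟨-, hsupχ⟩ := (hT1W' χ).1 hχW'
          set T₀ : Finset κ := cfail U (W'.erase v) χ with hT₀def
          have hT₀sub : T₀ ⊆ W'.erase v := filter_subset _ _
          have hcfW' : cfail U W' χ ⊆ insert v T₀ := by
            intro w hw
            rw [mem_cfail] at hw
            by_cases hwv : w = v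
            · rw [hwv]; exact mem_insert_self v T₀
            · refine mem_insert_of_mem ((mem_cfail U).2 ⟨mem_erase.2 ⟨hwv, hw.1⟩, ?_⟩)
              rw [cframe_erase U hU hne hW's hWvs (mem_erase.2 ⟨hwv, hw.1⟩)]
              exact hw.2
          -- KEY compatibility: `φ` is safe for every family between `T₀` and `W' ∖ v`
          have key : ∀ R₁ : Finset κ, T₀ ⊆ R₁ → R₁ ⊆ W'.erase v → φ ∈ Safe U R₁ := by
            intro R₁ h1 h2
            have hvR₁ : v ∉ R₁ := fun h => (mem_erase.1 (h2 h)).1 rfl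
            have hR₁' : insert v R₁ ⊆ W' := insert_subset hvW' (h2.trans (erase_subset v W'))
            have hrob₁ : ∀ R'', insert v R₁ ⊆ R'' → R'' ⊆ W' → Structured U R'' :=
              fun R'' h3 h4 => hsupχ R'' (hcfW'.trans ((insert_subset_insert v h1).trans h3)) h4
            have hs₁ : Structured U (insert v R₁) := hrob₁ _ subset_rfl hR₁'
            have hcf₁ : cframe U (insert v R₁) v = cframe U W' v :=
              cframe_eq_of_robust U hU hne _ le_rfl hW's hR₁' hrob₁ v (mem_insert_self v R₁)
            have hN₁ : ¬ (cframe U (insert v R₁) v ⊆ U v) := by rwa [hcf₁]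
            have hcard₁ : (insert v R₁).card ≤ n := (card_le_card hR₁').trans hW'n
            have := annihilator_subset_safe_erase_aux hU hne n hcard₁ hs₁ (mem_insert_self v R₁) hN₁
            rw [erase_insert hvR₁, hcf₁] at this
            exact this hφ'
          -- now `χ ∈ Safe R₀` by T1 for `R₀`
          rw [hl₀R]
          refine (hT1R₀ χ).2 ⟨?_, fun R₃ h3 h4 => ?_⟩
          · -- size: `cfail R₀ χ ⊇ T₀ ∩ Q`, and `φ ∈ Safe T₀` gives `|T₀ ∩ Q| ≥ 2`
            have hφT₀ := key T₀ subset_rfl hT₀sub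
            refine ((mem_safe U).1 hφT₀).1.trans (card_le_card fun w hw => ?_)
            rw [mem_failSet] at hw
            rw [mem_cfail]
            have hwQ : w ∈ Q := (mem_failSet U).2 ⟨hT₀sub hw.1, hw.2⟩
            refine ⟨hQR₀ hwQ, ?_⟩
            rw [hfrR₀ w (hQR₀ hwQ)]
            exact ((mem_cfail U).1 hw.1).2
          · -- supersets: `R₁ := R₃ ∪ T₀`
            have hφR₁ := key (R₃ ∪ T₀) subset_union_right (union_subset (h4.trans hR₀sub) hT₀sub)
            refine ((mem_safe U).1 hφR₁).2 R₃ (fun w hw => ?_) subset_union_left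
            rw [mem_failSet] at hw
            rcases mem_union.1 hw.1 with hw3 | hwT
            · exact hw3
            · -- `w ∈ T₀ ∩ Q ⊆ cfail R₀ χ ⊆ R₃`
              have hwQ : w ∈ Q := (mem_failSet U).2 ⟨hT₀sub hwT, hw.2⟩
              refine h3 ((mem_cfail U).2 ⟨hQR₀ hwQ, ?_⟩)
              rw [hfrR₀ w (hQR₀ hwQ)]
              exact ((mem_cfail U).1 hwT).2

/-- **SYM (STRUCTURE-THEORY 3.8): the annihilator of a removable member is safe for the rest.** [this work] -/
theorem annihilator_subset_safe_erase (hU : ∀ k, IsUpperSet (U k)) (hne : ∀ k, (U k).Nonempty) {W : Finset κ}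
    (hW : Structured U W) {v : κ} (hv : v ∈ W) (hWv : Structured U (W.erase v)) :
    cframe U W v \ U v ⊆ Safe U (W.erase v) := by
  by_cases hN : cframe U W v ⊆ U v
  · intro φ hφ; exact absurd (hN hφ.1) hφ.2
  · have _ := hWv
    exact annihilator_subset_safe_erase_aux U hU hne W.card le_rfl hW hv hN

/-- **Removable members are last-able**: if `W` is structured, `v ∈ W`, and `l₂` is a good chain of `W ∖ v`, then `v :: l₂` is a good
chain (of `W`). [this work] -/
theorem goodChain_cons_of_structured_erase (hU : ∀ k, IsUpperSet (U k)) (hne : ∀ k, (U k).Nonempty) {W : Finset κ}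
    (hW : Structured U W) {v : κ} (hv : v ∈ W) {l₂ : List κ} (hl₂W : l₂.toFinset = W.erase v) (hl₂ : GoodChain U l₂) :
    GoodChain U (v :: l₂) := by
  rw [goodChain_cons]
  refine ⟨hl₂, fun h => (mem_erase.1 (hl₂W ▸ List.mem_toFinset.2 h : v ∈ W.erase v)).1 rfl, ?_⟩
  rw [hull_frameSupp_erase U hU hne hW hv hl₂W hl₂, hl₂W]
  exact annihilator_subset_safe_erase U hU hne hW hv ⟨l₂, hl₂W, hl₂⟩

end Summit.CriticalPhenomena.PercolationContinuityZ3.Theorems
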